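import Summits.BirchSwinnertonDyer.BirchSwinnertonDyer.Theorems.ClassRecordThreeRung62310y1HeightEvalSigma
import Summits.BirchSwinnertonDyer.BirchSwinnertonDyer.Theorems.ClassRecordThreeRung62310y1HeightEvalFormalLog
import Literature.NumberTheory.EllipticCurves.PAdicHeightsLogProofs
import Literature.NumberTheory.EllipticCurves.PadicFormalLogOrder
import HarnessLib

/-!
# Route `ClassRecordThree`, crux `SchneiderAtThree` (item 19106): a GENERIC first-order kernel evaluator for the
# Stein–Wuthrich §4.2 height, part 1 — `C²`, `z(Q)`, `log_Ŵ(z)` and `w = log_Ŵ(z)²/C²` modulo `3⁴` from an integer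
# RESIDUE CERTIFICATE (cell `bsd-stepL`, seat `bsd-stepL-reg3-eng` g3; `--supports stmt-BirchSwinnertonDyer-19106`)

HONEST FRAMING: BSD is not proved by any of this; nothing here closes the crux; Schneider's non-degeneracy conjecture
(barrier `PAdicHeightNondegeneracy`) is asserted NOWHERE. This file and its sequel (`…RegCertKernelHeight`) generalise
the one-curve evaluator of the BC5 rung `62310y1` (`…Rung62310y1HeightEval*` / `…Witness`, seat g2) to EVERY row of the
REG3CERT table (kit j249075 / j249895; `run/shared/lean/pub/bsd-stepL/reg3/REG3CERT-TABLE.md`) whose certificate point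
`Q = (a/e², b/e³)` has `v₃(e) = 1` and whose height has `v₃(h(Q)) = 1` (314 of the 723 TRUE-OPEN non-split (ram) X11b@3
rows): for such a row the residue of `h = heightFourOneCoord W 3 q x(Q) y(Q)` modulo `9` is determined, through the
tree's FIRST-ORDER `3`-adic lemmas only, by six integers `(γ, ζ, ℓ, ω, κ, u)` subject to integer divisibilities that
`norm_num` / `decide` check per row. This part proves, for arbitrary `W/ℚ` (globally minimal, for `3`-integrality of the
formal group) and arbitrary `‖q‖₃ ≤ 3⁻¹` (the Tate parameter's equation `j(q) = j(W)` is not needed at this order):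

* §1 `norm_uniformisationScaleSq_sub_le`: `‖C² − γ‖ ≤ 3⁻²` from `9 ∣ c₄(W) + γ·c₆(W)`, `3 ∤ c₆(W)`
  (`C² = −c₄(W)/c₆(W)·(1 − 504s₅(q))/(1 + 240s₃(q))`, tree `TateCurve/Invariants`);
* §2 `norm_z_sub_le`: `‖z − ζ‖ ≤ 3⁻⁴` for `z = −ae/b` from `81 ∣ ae + ζb` (`3 ∣ e`, `3 ∤ b`);
  `norm_padicFormalLog_sub_intCast_le`: `‖log_Ŵ(z) − ℓ‖ ≤ 3⁻⁴` from `3⁵ ∣ 6ζ + 3a₁ζ² + 2(a₁² + a₂)ζ³ − 6ℓ`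
  (cubic expansion `norm_padicFormalLog_sub_cubic_le`, p426807);
* §3 `norm_sq_div_sub_intCast_le` / `norm_logUnitParamSq_sub_intCast_le`: `‖logUnitParamSq W 3 q x y − ω‖ ≤ 3⁻⁴` from
  `81 ∣ ℓ² − ωγ` (`9 ∣ ω`, `3 ∤ γ`).

Part 2 continues with `κ ≡ ch(w) − 1`, `σ² ≡ 2κ`, the two Iwasawa logarithms and `h ≡ (e'⁴ − u²)/2 (mod 9)`.
Theorems only (0 defs, 0 facts).

References: [SteinWuthrich2013] §4.2; [SilvermanATAEC1994] V.3; [SilvermanAEC2009] IV.5–6.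
-/

open scoped Classical

open WeierstrassCurve Literature.NumberTheory.EllipticCurves
  Literature.NumberTheory.EllipticCurves.SteinWuthrich2013
  Summit.BirchSwinnertonDyer.Rank1Residual.X11b.RegMult.Rung62310y1

namespace Summit.BirchSwinnertonDyer.Rank1Residual.X11b.RegMult.KernelCert

/-! ### §0 Plumbing: norms of integers in `ℚ₃` -/

/-- In `ℚ₃`, `‖q‖ < 1` forces `‖q‖ ≤ 3⁻¹` (the value group is `3^ℤ`). [folklore] -/
theorem norm_le_third_of_norm_lt_one {q : ℚ_[3]} (h : ‖q‖ < 1) : ‖q‖ ≤ 1 / 3 := by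
  have h' := (Padic.norm_le_pow_iff_norm_lt_pow_add_one q (-1)).mpr (by norm_num; exact h)
  refine h'.trans ?_
  norm_num

/-- `3^k ∣ n ⇒ ‖n‖₃ ≤ 3⁻ᵏ` for an integer `n`. [folklore] -/
theorem norm_intCast_le_of_pow_dvd {n : ℤ} {k : ℕ} (h : (3 : ℤ) ^ k ∣ n) : ‖(n : ℚ_[3])‖ ≤ 1 / (3 : ℝ) ^ k := by
  have h' := (Padic.norm_int_le_pow_iff_dvd (p := 3) n k).mpr (by exact_mod_cast h)
  refine h'.trans (le_of_eq ?_)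
  rw [zpow_neg, zpow_natCast]
  norm_num

/-- `3 ∤ n ⇒ ‖n‖₃ = 1` for an integer `n`. [folklore] -/
theorem norm_intCast_eq_one_of_not_dvd {n : ℤ} (h : ¬ (3 : ℤ) ∣ n) : ‖(n : ℚ_[3])‖ = 1 := by
  refine le_antisymm (Padic.norm_int_le_one n) (not_lt.mp fun hlt => h ?_)
  exact_mod_cast (Padic.norm_intCast_lt_one_iff (p := 3) (k := n)).mp hlt

/-- Ultrametric inequality for differences. [folklore] -/
private theorem norm_sub_le_max₀ (a b : ℚ_[3]) : ‖a - b‖ ≤ max ‖a‖ ‖b‖ := by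
  rw [sub_eq_add_neg, ← norm_neg b]; exact IsUltrametricDist.norm_add_le_max a (-b)

/-- `‖(2 : ℚ₃)⁻¹‖ = 1`. [folklore] -/
private theorem norm_inv_two : ‖(2 : ℚ_[3])⁻¹‖ = 1 := by
  rw [norm_inv, show (2 : ℚ_[3]) = ((2 : ℤ) : ℚ_[3]) by norm_cast, norm_intCast_eq_one_of_not_dvd (by decide),
    inv_one]

/-- `‖(3 : ℚ₃)⁻¹‖ = 3`. [folklore] -/
private theorem norm_inv_three : ‖(3 : ℚ_[3])⁻¹‖ = 3 := by
  rw [norm_inv, show (3 : ℚ_[3]) = ((3 : ℕ) : ℚ_[3]) by norm_cast, Padic.norm_p]; norm_num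

/-- `‖(6 : ℚ₃)⁻¹‖ = 3`. [folklore] -/
private theorem norm_inv_six : ‖(6 : ℚ_[3])⁻¹‖ = 3 := by
  rw [show (6 : ℚ_[3]) = 2 * 3 by norm_num, mul_inv, norm_mul, norm_inv_two, norm_inv_three, one_mul]

/-- `‖(24 : ℚ₃)⁻¹‖ = 3`. [folklore] -/
private theorem norm_inv_twentyfour : ‖(24 : ℚ_[3])⁻¹‖ = 3 := by
  have h8 : ‖(8 : ℚ_[3])⁻¹‖ = 1 := by
    rw [norm_inv, show (8 : ℚ_[3]) = ((8 : ℤ) : ℚ_[3]) by norm_cast, norm_intCast_eq_one_of_not_dvd (by decide),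
      inv_one]
  rw [show (24 : ℚ_[3]) = 8 * 3 by norm_num, mul_inv, norm_mul, h8, norm_inv_three, one_mul]

/-! ### §1 The uniformisation scale: `C² ≡ γ (mod 9)` -/

/-- **`C² ≡ −c₄(W)/c₆(W) (mod 9)`.** For any `W/ℚ` whose `c₆` is a `3`-adic unit, any integer `γ` with
`9 ∣ c₄ + γ·c₆`, and any `‖q‖₃ ≤ 3⁻¹`: `‖uniformisationScaleSq W 3 q − γ‖₃ ≤ 3⁻²`. Here
`C² = c₆(E_q)c₄(W)/(c₄(E_q)c₆(W))` with `c₄(E_q) = 1 + 240 s₃(q)`, `c₆(E_q) = −(1 − 504 s₅(q))`, `‖s_k(q)‖ ≤ ‖q‖`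
(tree `TateCurve/Invariants`). [cite: SteinWuthrich2013, §4.2] [cite: SilvermanATAEC1994, Thm. V.3.1] -/
theorem norm_uniformisationScaleSq_sub_le (W : WeierstrassCurve ℚ) {c4 c6 γ : ℤ}
    (hc4 : (W.baseChange ℚ_[3]).c₄ = c4) (hc6 : (W.baseChange ℚ_[3]).c₆ = c6) (h3c6 : ¬ (3 : ℤ) ∣ c6)
    (hγ : (9 : ℤ) ∣ c4 + γ * c6) {q : ℚ_[3]} (hq : ‖q‖ ≤ 1 / 3) :
    ‖uniformisationScaleSq W 3 q - γ‖ ≤ 1 / 9 := by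
  have hq1 : ‖q‖ ≤ 1 := hq.trans (by norm_num)
  have hs3 : ‖tateS 3 q‖ ≤ 1 / 3 := (TateCurve.norm_tateS_le hq1).trans hq
  have hs5 : ‖tateS 5 q‖ ≤ 1 / 3 := (TateCurve.norm_tateS_le hq1).trans hq
  have h12 : (12 : ℚ_[3]) ≠ 0 := by norm_num
  rw [uniformisationScaleSq, TateCurve.tateCurve_c₄, TateCurve.tateCurve_c₆ h12, hc4, hc6, TateCurve.tateE4_eq,
    TateCurve.tateE6]
  set s3 := tateS 3 q
  set s5 := tateS 5 q
  have hc6n : ‖(c6 : ℚ_[3])‖ = 1 := norm_intCast_eq_one_of_not_dvd h3c6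
  have hc4n : ‖(c4 : ℚ_[3])‖ ≤ 1 := Padic.norm_int_le_one _
  have hγn : ‖(γ : ℚ_[3])‖ ≤ 1 := Padic.norm_int_le_one _
  have h240 : ‖(240 : ℚ_[3])‖ ≤ 1 / 3 := by
    rw [show (240 : ℚ_[3]) = ((240 : ℤ) : ℚ_[3]) by norm_cast]
    exact (norm_intCast_le_of_pow_dvd (k := 1) (by norm_num)).trans (by norm_num)
  have h504 : ‖(504 : ℚ_[3])‖ ≤ 1 / 9 := by
    rw [show (504 : ℚ_[3]) = ((504 : ℤ) : ℚ_[3]) by norm_cast]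
    exact (norm_intCast_le_of_pow_dvd (k := 2) (by norm_num)).trans (by norm_num)
  have hD : ‖(1 + 240 * s3) * (c6 : ℚ_[3])‖ = 1 := by
    have hsub : ‖(1 + 240 * s3) * (c6 : ℚ_[3]) - c6‖ < ‖(c6 : ℚ_[3])‖ := by
      rw [hc6n, show (1 + 240 * s3) * (c6 : ℚ_[3]) - c6 = 240 * s3 * c6 by ring, norm_mul, norm_mul, hc6n]
      calc ‖(240 : ℚ_[3])‖ * ‖s3‖ * 1 ≤ 1 / 3 * (1 / 3) * 1 := by gcongr
        _ < 1 := by norm_num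
    rw [Padic.norm_eq_of_norm_sub_lt_right hsub, hc6n]
  have hD0 : (1 + 240 * s3) * (c6 : ℚ_[3]) ≠ 0 := by
    intro h; rw [h, norm_zero] at hD; exact zero_ne_one hD
  rw [div_sub' hD0, norm_div, hD, div_one]
  have hnum : -(1 - 504 * s5) * (c4 : ℚ_[3]) - (1 + 240 * s3) * (c6 : ℚ_[3]) * (γ : ℚ_[3]) =
      -(((c4 + γ * c6 : ℤ) : ℚ_[3])) + 504 * (c4 : ℚ_[3]) * s5 + -(240 * (γ : ℚ_[3]) * (c6 : ℚ_[3]) * s3) := by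
    push_cast; ring
  rw [hnum]
  have h1 : ‖-(((c4 + γ * c6 : ℤ) : ℚ_[3]))‖ ≤ 1 / 9 := by
    rw [norm_neg]; exact (norm_intCast_le_of_pow_dvd (k := 2) (by norm_num; exact hγ)).trans (by norm_num)
  have h2 : ‖504 * (c4 : ℚ_[3]) * s5‖ ≤ 1 / 9 := by
    rw [norm_mul, norm_mul]
    calc ‖(504 : ℚ_[3])‖ * ‖(c4 : ℚ_[3])‖ * ‖s5‖ ≤ 1 / 9 * 1 * (1 / 3) := by gcongr
      _ ≤ 1 / 9 := by norm_num
  have h3 : ‖-(240 * (γ : ℚ_[3]) * (c6 : ℚ_[3]) * s3)‖ ≤ 1 / 9 := by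
    rw [norm_neg, norm_mul, norm_mul, norm_mul, hc6n]
    calc ‖(240 : ℚ_[3])‖ * ‖(γ : ℚ_[3])‖ * 1 * ‖s3‖ ≤ 1 / 3 * 1 * 1 * (1 / 3) := by gcongr
      _ = 1 / 9 := by norm_num
  refine (IsUltrametricDist.norm_add_le_max _ _).trans (max_le ?_ h3)
  exact (IsUltrametricDist.norm_add_le_max _ _).trans (max_le h1 h2)

/-! ### §2 The formal logarithm of `z(Q) = −ae/b`: `log_Ŵ(z) ≡ ℓ (mod 3⁴)` -/

/-- `z(Q) = −x/y = −ae/b` in `ℚ₃` for `x = a/e²`, `y = b/e³` (`b, e ≠ 0`). [folklore] -/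
theorem neg_div_cast_eq {a b : ℤ} {e : ℕ} (hb : b ≠ 0) (he : e ≠ 0) :
    -(((a / (e : ℚ) ^ 2 : ℚ) : ℚ_[3])) / (((b / (e : ℚ) ^ 3 : ℚ) : ℚ_[3])) =
      -((a : ℚ_[3]) * (e : ℚ_[3])) / (b : ℚ_[3]) := by
  have hb' : (b : ℚ_[3]) ≠ 0 := by exact_mod_cast hb
  have he' : (e : ℚ_[3]) ≠ 0 := by exact_mod_cast he
  push_cast
  field_simp

/-- **`z ≡ ζ (mod 3⁴)` and `‖z‖ ≤ 3⁻¹`** for `z = −ae/b` with `3 ∣ e`, `3 ∤ b`, `81 ∣ ae + ζb`. [folklore] -/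
theorem norm_z_sub_le {a b ζ : ℤ} {e : ℕ} (h3e : (3 : ℤ) ∣ e) (h3b : ¬ (3 : ℤ) ∣ b)
    (hζ : (81 : ℤ) ∣ a * e + ζ * b) :
    ‖-((a : ℚ_[3]) * (e : ℚ_[3])) / (b : ℚ_[3]) - ζ‖ ≤ 1 / 81 ∧
      ‖-((a : ℚ_[3]) * (e : ℚ_[3])) / (b : ℚ_[3])‖ ≤ 1 / 3 := by
  have hbn : ‖(b : ℚ_[3])‖ = 1 := norm_intCast_eq_one_of_not_dvd h3b
  have hb0 : (b : ℚ_[3]) ≠ 0 := by intro h; rw [h, norm_zero] at hbn; exact zero_ne_one hbn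
  have hen : ‖((e : ℤ) : ℚ_[3])‖ ≤ 1 / 3 :=
    (norm_intCast_le_of_pow_dvd (k := 1) (by rw [pow_one]; exact h3e)).trans (by norm_num)
  have hen' : ‖(e : ℚ_[3])‖ ≤ 1 / 3 := by exact_mod_cast hen
  refine ⟨?_, ?_⟩
  · have h : -((a : ℚ_[3]) * (e : ℚ_[3])) / (b : ℚ_[3]) - ζ = -(((a * e + ζ * b : ℤ) : ℚ_[3])) / (b : ℚ_[3]) := by
      push_cast; field_simp; ring
    rw [h, norm_div, norm_neg, hbn, div_one]
    exact (norm_intCast_le_of_pow_dvd (k := 4) (by norm_num; exact hζ)).trans (by norm_num)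
  · rw [norm_div, norm_neg, norm_mul, hbn, div_one]
    calc ‖(a : ℚ_[3])‖ * ‖(e : ℚ_[3])‖ ≤ 1 * (1 / 3) := by gcongr; exact Padic.norm_int_le_one _
      _ = 1 / 3 := one_mul _

/-- **`log_Ŵ(z) ≡ ℓ (mod 3⁴)`**: for a globally minimal `W/ℚ` (so `Ŵ` is `3`-integral) with `a₁, a₂` as given, any
`z ∈ ℚ₃` and integers `ζ, ℓ` with `‖z − ζ‖ ≤ 3⁻⁴`, `‖z‖ ≤ 3⁻¹` and `3⁵ ∣ 6ζ + 3a₁ζ² + 2(a₁² + a₂)ζ³ − 6ℓ`: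
`‖(W ⊗ ℚ₃).padicFormalLog z − ℓ‖ ≤ 3⁻⁴` and `‖ℓ‖ ≤ 3⁻¹`. The cubic expansion `log_Ŵ(z) = z + a₁z²/2 + (a₁²+a₂)z³/3 +
O(3⁻⁴)` is `norm_padicFormalLog_sub_cubic_le` (p426807); the passage `z ↦ ζ` costs
`‖z − ζ‖·‖1 + a₁(z+ζ)/2 + (a₁²+a₂)(z²+zζ+ζ²)/3‖ ≤ 3⁻⁴`. [cite: SilvermanAEC2009, IV.6.4] -/
theorem norm_padicFormalLog_sub_intCast_le (W : WeierstrassCurve ℚ) [W.IsGloballyMinimal] {a₁ a₂ ζ ℓ : ℤ}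
    (ha1 : (W.baseChange ℚ_[3]).a₁ = a₁) (ha2 : (W.baseChange ℚ_[3]).a₂ = a₂)
    (hℓ : (243 : ℤ) ∣ 6 * ζ + 3 * a₁ * ζ ^ 2 + 2 * (a₁ ^ 2 + a₂) * ζ ^ 3 - 6 * ℓ)
    {z : ℚ_[3]} (hzζ : ‖z - ζ‖ ≤ 1 / 81) (hz : ‖z‖ ≤ 1 / 3) :
    ‖(W.baseChange ℚ_[3]).padicFormalLog z - ℓ‖ ≤ 1 / 81 ∧ ‖(ℓ : ℚ_[3])‖ ≤ 1 / 3 := by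
  set V := W.baseChange ℚ_[3] with hV
  have hcub := norm_padicFormalLog_sub_cubic_le V hz
  rw [ha1, ha2] at hcub
  have hζn : ‖(ζ : ℚ_[3])‖ ≤ 1 / 3 := by
    have : (ζ : ℚ_[3]) = z - (z - ζ) := by ring
    rw [this]; exact (norm_sub_le_max₀ _ _).trans (max_le hz (hzζ.trans (by norm_num)))
  have ha1n : ‖(a₁ : ℚ_[3])‖ ≤ 1 := Padic.norm_int_le_one _
  have ha2n : ‖((a₁ ^ 2 + a₂ : ℤ) : ℚ_[3])‖ ≤ 1 := Padic.norm_int_le_one _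
  -- the cubic polynomial at `z` versus at `ζ`
  have hdiff : (z + (2 : ℚ_[3])⁻¹ * a₁ * z ^ 2 + (3 : ℚ_[3])⁻¹ * (a₁ ^ 2 + a₂) * z ^ 3) -
      ((ζ : ℚ_[3]) + (2 : ℚ_[3])⁻¹ * a₁ * (ζ : ℚ_[3]) ^ 2 + (3 : ℚ_[3])⁻¹ * (a₁ ^ 2 + a₂) * (ζ : ℚ_[3]) ^ 3) =
      (z - ζ) * (1 + (2 : ℚ_[3])⁻¹ * a₁ * (z + ζ) +
        (3 : ℚ_[3])⁻¹ * ((a₁ ^ 2 + a₂ : ℤ) : ℚ_[3]) * (z ^ 2 + z * ζ + (ζ : ℚ_[3]) ^ 2)) := by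
    push_cast; ring
  have hbr : ‖1 + (2 : ℚ_[3])⁻¹ * a₁ * (z + ζ) +
      (3 : ℚ_[3])⁻¹ * ((a₁ ^ 2 + a₂ : ℤ) : ℚ_[3]) * (z ^ 2 + z * ζ + (ζ : ℚ_[3]) ^ 2)‖ ≤ 1 := by
    have hzζ' : ‖z + ζ‖ ≤ 1 / 3 := (IsUltrametricDist.norm_add_le_max _ _).trans (max_le hz hζn)
    have hq2 : ‖z ^ 2 + z * ζ + (ζ : ℚ_[3]) ^ 2‖ ≤ 1 / 9 := by
      refine (IsUltrametricDist.norm_add_le_max _ _).trans (max_le ?_ ?_)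
      · refine (IsUltrametricDist.norm_add_le_max _ _).trans (max_le ?_ ?_)
        · rw [norm_pow]; calc ‖z‖ ^ 2 ≤ (1 / 3) ^ 2 := by gcongr
            _ = 1 / 9 := by norm_num
        · rw [norm_mul]; calc ‖z‖ * ‖(ζ : ℚ_[3])‖ ≤ 1 / 3 * (1 / 3) := by gcongr
            _ = 1 / 9 := by norm_num
      · rw [norm_pow]; calc ‖(ζ : ℚ_[3])‖ ^ 2 ≤ (1 / 3) ^ 2 := by gcongr
          _ = 1 / 9 := by norm_num
    refine (IsUltrametricDist.norm_add_le_max _ _).trans (max_le ?_ ?_)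
    · refine (IsUltrametricDist.norm_add_le_max _ _).trans (max_le (by rw [norm_one]) ?_)
      rw [norm_mul, norm_mul, norm_inv_two]
      calc 1 * ‖(a₁ : ℚ_[3])‖ * ‖z + ζ‖ ≤ 1 * 1 * (1 / 3) := by gcongr
        _ ≤ 1 := by norm_num
    · rw [norm_mul, norm_mul, norm_inv_three]
      calc 3 * ‖((a₁ ^ 2 + a₂ : ℤ) : ℚ_[3])‖ * ‖z ^ 2 + z * ζ + (ζ : ℚ_[3]) ^ 2‖ ≤ 3 * 1 * (1 / 9) := by gcongr
        _ ≤ 1 := by norm_num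
  have hstep2 : ‖(z + (2 : ℚ_[3])⁻¹ * a₁ * z ^ 2 + (3 : ℚ_[3])⁻¹ * (a₁ ^ 2 + a₂) * z ^ 3) -
      ((ζ : ℚ_[3]) + (2 : ℚ_[3])⁻¹ * a₁ * (ζ : ℚ_[3]) ^ 2 + (3 : ℚ_[3])⁻¹ * (a₁ ^ 2 + a₂) * (ζ : ℚ_[3]) ^ 3)‖ ≤
      1 / 81 := by
    rw [hdiff, norm_mul]
    calc ‖z - ζ‖ * _ ≤ 1 / 81 * 1 := by gcongr
      _ = 1 / 81 := mul_one _
  -- the cubic polynomial at `ζ` versus `ℓ`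
  have hstep3 : ‖((ζ : ℚ_[3]) + (2 : ℚ_[3])⁻¹ * a₁ * (ζ : ℚ_[3]) ^ 2 + (3 : ℚ_[3])⁻¹ * (a₁ ^ 2 + a₂) * (ζ : ℚ_[3]) ^ 3) -
      ℓ‖ ≤ 1 / 81 := by
    have h : ((ζ : ℚ_[3]) + (2 : ℚ_[3])⁻¹ * a₁ * (ζ : ℚ_[3]) ^ 2 + (3 : ℚ_[3])⁻¹ * (a₁ ^ 2 + a₂) * (ζ : ℚ_[3]) ^ 3) -
        ℓ = (6 : ℚ_[3])⁻¹ * (((6 * ζ + 3 * a₁ * ζ ^ 2 + 2 * (a₁ ^ 2 + a₂) * ζ ^ 3 - 6 * ℓ : ℤ) : ℚ_[3])) := by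
      have h2 : (2 : ℚ_[3]) ≠ 0 := by norm_num
      have h3 : (3 : ℚ_[3]) ≠ 0 := by norm_num
      have h6 : (6 : ℚ_[3]) ≠ 0 := by norm_num
      push_cast; field_simp; ring
    rw [h, norm_mul, norm_inv_six]
    calc 3 * ‖(((6 * ζ + 3 * a₁ * ζ ^ 2 + 2 * (a₁ ^ 2 + a₂) * ζ ^ 3 - 6 * ℓ : ℤ) : ℚ_[3]))‖ ≤ 3 * (1 / 243) := by
          gcongr; exact (norm_intCast_le_of_pow_dvd (k := 5) (by norm_num; exact hℓ)).trans (by norm_num)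
      _ = 1 / 81 := by norm_num
  have hmain : ‖V.padicFormalLog z - ℓ‖ ≤ 1 / 81 := by
    have hsplit : V.padicFormalLog z - ℓ =
        (V.padicFormalLog z - (z + (2 : ℚ_[3])⁻¹ * a₁ * z ^ 2 + (3 : ℚ_[3])⁻¹ * (a₁ ^ 2 + a₂) * z ^ 3)) +
        ((z + (2 : ℚ_[3])⁻¹ * a₁ * z ^ 2 + (3 : ℚ_[3])⁻¹ * (a₁ ^ 2 + a₂) * z ^ 3) -
          ((ζ : ℚ_[3]) + (2 : ℚ_[3])⁻¹ * a₁ * (ζ : ℚ_[3]) ^ 2 + (3 : ℚ_[3])⁻¹ * (a₁ ^ 2 + a₂) * (ζ : ℚ_[3]) ^ 3)) +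
        (((ζ : ℚ_[3]) + (2 : ℚ_[3])⁻¹ * a₁ * (ζ : ℚ_[3]) ^ 2 + (3 : ℚ_[3])⁻¹ * (a₁ ^ 2 + a₂) * (ζ : ℚ_[3]) ^ 3) -
          ℓ) := by ring
    rw [hsplit]
    refine (IsUltrametricDist.norm_add_le_max _ _).trans (max_le ?_ hstep3)
    exact (IsUltrametricDist.norm_add_le_max _ _).trans (max_le hcub hstep2)
  refine ⟨hmain, ?_⟩
  -- `‖ℓ‖ ≤ 3⁻¹`: `ℓ = L − (L − ℓ)` with `‖L‖ ≤ 3⁻¹` (`L = cubic + O(3⁻⁴)`, cubic of norm `≤ 3⁻¹`)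
  have hcubn : ‖z + (2 : ℚ_[3])⁻¹ * a₁ * z ^ 2 + (3 : ℚ_[3])⁻¹ * (a₁ ^ 2 + a₂) * z ^ 3‖ ≤ 1 / 3 := by
    refine (IsUltrametricDist.norm_add_le_max _ _).trans (max_le ?_ ?_)
    · refine (IsUltrametricDist.norm_add_le_max _ _).trans (max_le hz ?_)
      rw [norm_mul, norm_mul, norm_inv_two, norm_pow]
      calc 1 * ‖(a₁ : ℚ_[3])‖ * ‖z‖ ^ 2 ≤ 1 * 1 * (1 / 3) ^ 2 := by gcongr
        _ ≤ 1 / 3 := by norm_num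
    · rw [norm_mul, norm_mul, norm_inv_three, norm_pow]
      have : ‖((a₁ : ℚ_[3])) ^ 2 + (a₂ : ℚ_[3])‖ ≤ 1 := by
        have := ha2n; push_cast at this; exact this
      calc 3 * ‖((a₁ : ℚ_[3])) ^ 2 + (a₂ : ℚ_[3])‖ * ‖z‖ ^ 3 ≤ 3 * 1 * (1 / 3) ^ 3 := by gcongr
        _ ≤ 1 / 3 := by norm_num
  have hLn : ‖V.padicFormalLog z‖ ≤ 1 / 3 := by
    have : V.padicFormalLog z = (V.padicFormalLog z -
        (z + (2 : ℚ_[3])⁻¹ * a₁ * z ^ 2 + (3 : ℚ_[3])⁻¹ * (a₁ ^ 2 + a₂) * z ^ 3)) +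
        (z + (2 : ℚ_[3])⁻¹ * a₁ * z ^ 2 + (3 : ℚ_[3])⁻¹ * (a₁ ^ 2 + a₂) * z ^ 3) := by ring
    rw [this]
    exact (IsUltrametricDist.norm_add_le_max _ _).trans (max_le (hcub.trans (by norm_num)) hcubn)
  have : (ℓ : ℚ_[3]) = V.padicFormalLog z - (V.padicFormalLog z - ℓ) := by ring
  rw [this]
  exact (norm_sub_le_max₀ _ _).trans (max_le hLn (hmain.trans (by norm_num)))

/-! ### §3 `w = log_Ŵ(z)²/C² ≡ ω (mod 3⁴)` -/

/-- **`w ≡ ω (mod 3⁴)`**: if `‖L − ℓ‖ ≤ 3⁻⁴`, `‖ℓ‖ ≤ 3⁻¹`, `‖C² − γ‖ ≤ 3⁻²`, `3 ∤ γ`, `9 ∣ ω` and `81 ∣ ℓ² − ωγ`, then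
`‖L²/C² − ω‖ ≤ 3⁻⁴` and `‖L²/C²‖ ≤ 3⁻²` (`L² − ωC² = (L² − ℓ²) + (ℓ² − ωγ) − ω(C² − γ)`, `‖C²‖ = 1`). [folklore] -/
theorem norm_sq_div_sub_intCast_le {L C2 : ℚ_[3]} {ℓ γ ω : ℤ} (hL : ‖L - ℓ‖ ≤ 1 / 81) (hℓ : ‖(ℓ : ℚ_[3])‖ ≤ 1 / 3)
    (hC : ‖C2 - γ‖ ≤ 1 / 9) (h3γ : ¬ (3 : ℤ) ∣ γ) (hω9 : (9 : ℤ) ∣ ω) (hω : (81 : ℤ) ∣ ℓ ^ 2 - ω * γ) :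
    ‖L ^ 2 / C2 - ω‖ ≤ 1 / 81 ∧ ‖L ^ 2 / C2‖ ≤ 1 / 9 := by
  have hγn : ‖(γ : ℚ_[3])‖ = 1 := norm_intCast_eq_one_of_not_dvd h3γ
  have hCn : ‖C2‖ = 1 := by
    rw [← hγn]; exact Padic.norm_eq_of_norm_sub_lt_right (hC.trans_lt (by rw [hγn]; norm_num))
  have hC0 : C2 ≠ 0 := by intro h; rw [h, norm_zero] at hCn; exact zero_ne_one hCn
  have hωn : ‖(ω : ℚ_[3])‖ ≤ 1 / 9 := (norm_intCast_le_of_pow_dvd (k := 2) (by norm_num; exact hω9)).trans (by norm_num)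
  have hLn : ‖L‖ ≤ 1 / 3 := by
    have : L = (L - ℓ) + ℓ := by ring
    rw [this]; exact (IsUltrametricDist.norm_add_le_max _ _).trans (max_le (hL.trans (by norm_num)) hℓ)
  have hL2 : ‖L ^ 2 - (ℓ : ℚ_[3]) ^ 2‖ ≤ 1 / 243 := by
    have : L ^ 2 - (ℓ : ℚ_[3]) ^ 2 = (L - ℓ) * (L + ℓ) := by ring
    rw [this, norm_mul]
    calc ‖L - ℓ‖ * ‖L + ℓ‖ ≤ 1 / 81 * (1 / 3) := by
          gcongr; exact (IsUltrametricDist.norm_add_le_max _ _).trans (max_le hLn hℓ)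
      _ = 1 / 243 := by norm_num
  have hnum : ‖L ^ 2 - (ω : ℚ_[3]) * C2‖ ≤ 1 / 81 := by
    have : L ^ 2 - (ω : ℚ_[3]) * C2 =
        (L ^ 2 - (ℓ : ℚ_[3]) ^ 2) + (((ℓ ^ 2 - ω * γ : ℤ) : ℚ_[3])) + -((ω : ℚ_[3]) * (C2 - γ)) := by
      push_cast; ring
    rw [this]
    refine (IsUltrametricDist.norm_add_le_max _ _).trans (max_le ?_ ?_)
    · refine (IsUltrametricDist.norm_add_le_max _ _).trans (max_le (hL2.trans (by norm_num)) ?_)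
      exact (norm_intCast_le_of_pow_dvd (k := 4) (by norm_num; exact hω)).trans (by norm_num)
    · rw [norm_neg, norm_mul]
      calc ‖(ω : ℚ_[3])‖ * ‖C2 - γ‖ ≤ 1 / 9 * (1 / 9) := by gcongr
        _ = 1 / 81 := by norm_num
  refine ⟨?_, ?_⟩
  · rw [div_sub' hC0, norm_div, hCn, div_one, mul_comm]; exact hnum
  · rw [norm_div, hCn, div_one, norm_pow]
    calc ‖L‖ ^ 2 ≤ (1 / 3) ^ 2 := by gcongr
      _ = 1 / 9 := by norm_num

/-- **`logUnitParamSq W 3 q x y ≡ ω (mod 3⁴)`** — the chain of §§1–3 on the tree's definition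
`logUnitParamSq W 3 q x y = log_Ŵ(−x/y)²/C²`, for a globally minimal `W/ℚ` with `a₁, a₂, c₄, c₆` as given (`c₆` a `3`-adic
unit), a point `(x, y) = (a/e², b/e³)` with `3 ∣ e`, `3 ∤ b`, and integers `γ, ζ, ℓ, ω` satisfying the four divisibilities.
For every `‖q‖₃ ≤ 3⁻¹`: `‖logUnitParamSq W 3 q x y − ω‖ ≤ 3⁻⁴`, `‖logUnitParamSq W 3 q x y‖ ≤ 3⁻²`, and
`‖uniformisationScaleSq W 3 q − γ‖ ≤ 3⁻²`. [cite: SteinWuthrich2013, §4.2] -/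
theorem norm_logUnitParamSq_sub_intCast_le (W : WeierstrassCurve ℚ) [W.IsGloballyMinimal] {a₁ a₂ c4 c6 : ℤ}
    (ha1 : (W.baseChange ℚ_[3]).a₁ = a₁) (ha2 : (W.baseChange ℚ_[3]).a₂ = a₂)
    (hc4 : (W.baseChange ℚ_[3]).c₄ = c4) (hc6 : (W.baseChange ℚ_[3]).c₆ = c6) (h3c6 : ¬ (3 : ℤ) ∣ c6)
    {a b : ℤ} {e : ℕ} (hb : b ≠ 0) (he : e ≠ 0) (h3e : (3 : ℤ) ∣ e) (h3b : ¬ (3 : ℤ) ∣ b)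
    {x y : ℚ} (hx : x = a / (e : ℚ) ^ 2) (hy : y = b / (e : ℚ) ^ 3)
    {γ ζ ℓ ω : ℤ} (hγ : (9 : ℤ) ∣ c4 + γ * c6) (h3γ : ¬ (3 : ℤ) ∣ γ) (hζ : (81 : ℤ) ∣ a * e + ζ * b)
    (hℓ : (243 : ℤ) ∣ 6 * ζ + 3 * a₁ * ζ ^ 2 + 2 * (a₁ ^ 2 + a₂) * ζ ^ 3 - 6 * ℓ)
    (hω9 : (9 : ℤ) ∣ ω) (hω : (81 : ℤ) ∣ ℓ ^ 2 - ω * γ) {q : ℚ_[3]} (hq : ‖q‖ ≤ 1 / 3) :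
    ‖logUnitParamSq W 3 q x y - ω‖ ≤ 1 / 81 ∧ ‖logUnitParamSq W 3 q x y‖ ≤ 1 / 9 ∧
      ‖uniformisationScaleSq W 3 q - γ‖ ≤ 1 / 9 := by
  have hC := norm_uniformisationScaleSq_sub_le W hc4 hc6 h3c6 hγ hq
  rw [logUnitParamSq, hx, hy, neg_div_cast_eq hb he]
  obtain ⟨hzζ, hz⟩ := norm_z_sub_le (ζ := ζ) h3e h3b hζ
  obtain ⟨hL, hℓn⟩ := norm_padicFormalLog_sub_intCast_le W ha1 ha2 hℓ hzζ hz
  obtain ⟨h1, h2⟩ := norm_sq_div_sub_intCast_le hL hℓn hC h3γ hω9 hω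
  exact ⟨h1, h2, hC⟩

end Summit.BirchSwinnertonDyer.Rank1Residual.X11b.RegMult.KernelCert
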